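import Summits.CriticalPhenomena.PercolationContinuityZ3.Theorems.PercNearOneGluingNoHeavyLowerTailOneCutCertKronecker

/-!
# `NoHeavyLowerTail` (crux stmt-CriticalPhenomena-4575), certificate programme for the one-cut bound at
# `|A| = 5`: list-tables, the fast Kronecker construction and the box (de Casteljau) transform

Layer 2b of the kernel-checked certificate checker (prim-cert-2): the COMPUTABLE objects and their
correctness.  Corner tables are lists of length `2^m` indexed by the little-endian bitmask `enc2 g`
(`tabOf`); `krL` / `krN` build the Kronecker number `KR (2^s) T` of `…OneCutCertKronecker` by splitting
on the top coordinate and shifting (`krL_eq`, `krN_eq`: linear in the output size, so `native_decide`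
can evaluate it on `2^15`-entry tables); `boxTr` is the coordinatewise tensor transform by integer
`2 × 2` weights (`boxTr_eq`), used for the restriction of the multilinear data to a sub-box.

Nothing here mentions percolation; no proposition about the crux is asserted.
-/

namespace Summit.CriticalPhenomena.PercolationContinuityZ3.Theorems.OneCutCert

open Finset
open scoped BigOperators

variable {m : ℕ}

/-! ## Computable side: tables as lists, the fast Kronecker construction, the box transform -/

/-- Little-endian bitmask position of a corner: `Σ_i g_i 2^i`, by recursion on the top coordinate. [this work] -/
def enc2 : {m : ℕ} → (Fin m → Bool) → ℕ
  | 0, _ => 0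
  | m + 1, g => enc2 (fun i => g (Fin.castSucc i)) + (g (Fin.last m)).toNat * 2 ^ m

/-- `enc2 g < 2^m`. [this work] -/
theorem enc2_lt : ∀ {m : ℕ} (g : Fin m → Bool), enc2 g < 2 ^ m
  | 0, _ => by simp [enc2]
  | m + 1, g => by
    have := enc2_lt (fun i => g (Fin.castSucc i))
    unfold enc2
    cases g (Fin.last m) <;> simp [pow_succ] <;> omega

/-- `e3` splits off the top coordinate. [this work] -/
theorem e3_succ {m : ℕ} (g : Fin (m + 1) → Bool) :
    e3 g = e3 (fun i => g (Fin.castSucc i)) + (g (Fin.last m)).toNat * 3 ^ m := by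
  unfold e3
  rw [Fin.sum_univ_castSucc]
  simp only [Fin.val_castSucc, Fin.val_last]

/-- The table (as a function on corners) represented by a list. [this work] -/
def tabOf {m : ℕ} (l : List ℤ) (g : Fin m → Bool) : ℤ := l.getD (enc2 g) 0

/-- Fast Kronecker number of a list-table of length `2^L` in base `2^s`:
split into halves (top coordinate `0` / `1`) and shift. [this work] -/
def krL (s : ℕ) : ℕ → List ℤ → ℤ
  | 0, l => l.getD 0 0
  | L + 1, l => krL s L (l.take (2 ^ L)) + krL s L (l.drop (2 ^ L)) * (2 : ℤ) ^ (s * 3 ^ L)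

/-- Sums over corners of `m+1` coordinates split by the top coordinate. [folklore] -/
theorem sum_corner_succ {R : Type*} [AddCommMonoid R] {m : ℕ} (f : (Fin (m + 1) → Bool) → R) :
    ∑ g, f g = ∑ g : Fin m → Bool, f (Fin.snoc g false) + ∑ g : Fin m → Bool, f (Fin.snoc g true) := by
  rw [← (Fin.snocEquiv fun _ : Fin (m + 1) => Bool).sum_comp, Fintype.sum_prod_type, Fintype.sum_bool]
  rw [add_comm]
  rfl

/-- `enc2` of a `snoc`. [this work] -/
theorem enc2_snoc {m : ℕ} (g : Fin m → Bool) (b : Bool) :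
    enc2 (Fin.snoc g b : Fin (m + 1) → Bool) = enc2 g + b.toNat * 2 ^ m := by
  conv_lhs => unfold enc2
  simp [Fin.snoc_castSucc, Fin.snoc_last]

/-- `e3` of a `snoc`. [this work] -/
theorem e3_snoc {m : ℕ} (g : Fin m → Bool) (b : Bool) :
    e3 (Fin.snoc g b : Fin (m + 1) → Bool) = e3 g + b.toNat * 3 ^ m := by
  rw [e3_succ]
  simp only [Fin.snoc_castSucc, Fin.snoc_last]

/-- `2^(s k) = (2^s)^k` with the cast used by `KR`. [folklore] -/
theorem two_pow_mul_cast (s k : ℕ) : (2 : ℤ) ^ (s * k) = ((2 ^ s : ℕ) : ℤ) ^ k := by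
  push_cast; exact pow_mul 2 s k

/-- **Correctness of the fast Kronecker construction**: for a list of length `2^L`,
`krL s L l = KR (2^s) (tabOf l)`. [this work] -/
theorem krL_eq : ∀ (s L : ℕ) (l : List ℤ), l.length = 2 ^ L →
    krL s L l = KR (2 ^ s) (tabOf (m := L) l)
  | s, 0, l, hl => by
    unfold krL KR tabOf
    simp [enc2, e3]
  | s, L + 1, l, hl => by
    have h1 : (l.take (2 ^ L)).length = 2 ^ L := by rw [List.length_take, hl, pow_succ]; omega
    have h2 : (l.drop (2 ^ L)).length = 2 ^ L := by rw [List.length_drop, hl, pow_succ]; omega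
    unfold krL
    rw [krL_eq s L _ h1, krL_eq s L _ h2]
    unfold KR
    rw [sum_corner_succ, Finset.sum_mul]
    congr 1
    · refine Finset.sum_congr rfl fun g _ => ?_
      unfold tabOf
      rw [enc2_snoc, e3_snoc]
      simp only [Bool.toNat_false, zero_mul, add_zero]
      rw [List.getD_eq_getElem?_getD, List.getD_eq_getElem?_getD, List.getElem?_take_of_lt (enc2_lt g)]
    · refine Finset.sum_congr rfl fun g _ => ?_
      unfold tabOf
      rw [enc2_snoc, e3_snoc]
      simp only [Bool.toNat_true, one_mul]
      rw [List.getD_eq_getElem?_getD, List.getD_eq_getElem?_getD, List.getElem?_drop, add_comm (2 ^ L),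
        pow_add, mul_assoc, two_pow_mul_cast]

/-- One de Casteljau step on the top coordinate: new first half / second half from the halves `A0`
(top bit `0`) and `A1` (top bit `1`) with integer weights `φ b b'`. [this work] -/
def boxStep (φ : Bool → Bool → ℤ) (A0 A1 : List ℤ) : List ℤ :=
  List.zipWith (fun x y => φ false false * x + φ false true * y) A0 A1 ++
    List.zipWith (fun x y => φ true false * x + φ true true * y) A0 A1

/-- The coordinatewise (tensor) transform of a list-table of length `2^m` by the weights `φ i`,
recursion on the top coordinate. [this work] -/
def boxTr : (m : ℕ) → (Fin m → Bool → Bool → ℤ) → List ℤ → List ℤ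
  | 0, _, l => l
  | m + 1, φ, l =>
    boxStep (φ (Fin.last m)) (boxTr m (fun i => φ (Fin.castSucc i)) (l.take (2 ^ m)))
      (boxTr m (fun i => φ (Fin.castSucc i)) (l.drop (2 ^ m)))

/-- Length of `boxTr`. [this work] -/
theorem length_boxTr : ∀ (m : ℕ) (φ : Fin m → Bool → Bool → ℤ) (l : List ℤ), l.length = 2 ^ m →
    (boxTr m φ l).length = 2 ^ m
  | 0, φ, l, hl => by simpa [boxTr] using hl
  | m + 1, φ, l, hl => by
    have h1 : (l.take (2 ^ m)).length = 2 ^ m := by rw [List.length_take, hl, pow_succ]; omega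
    have h2 : (l.drop (2 ^ m)).length = 2 ^ m := by rw [List.length_drop, hl, pow_succ]; omega
    simp only [boxTr, boxStep, List.length_append, List.length_zipWith, length_boxTr m _ _ h1,
      length_boxTr m _ _ h2, min_self, pow_succ]
    omega

/-- Entries of `boxStep`. [this work] -/
theorem getD_boxStep {m : ℕ} (φ : Bool → Bool → ℤ) (A0 A1 : List ℤ) (h0 : A0.length = 2 ^ m)
    (h1 : A1.length = 2 ^ m) (g : Fin m → Bool) (b : Bool) :
    (boxStep φ A0 A1).getD (enc2 g + b.toNat * 2 ^ m) 0 =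
      φ b false * A0.getD (enc2 g) 0 + φ b true * A1.getD (enc2 g) 0 := by
  have hg := enc2_lt g
  unfold boxStep
  rw [List.getD_eq_getElem?_getD, List.getD_eq_getElem?_getD, List.getD_eq_getElem?_getD]
  cases b
  · simp only [Bool.toNat_false, zero_mul, add_zero]
    rw [List.getElem?_append_left (by rw [List.length_zipWith, h0, h1, min_self]; exact hg),
      List.getElem?_zipWith]
    rw [List.getElem?_eq_getElem (by rw [h0]; exact hg), List.getElem?_eq_getElem (by rw [h1]; exact hg)]
    rfl
  · simp only [Bool.toNat_true, one_mul]
    rw [List.getElem?_append_right (by rw [List.length_zipWith, h0, h1, min_self]; omega),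
      List.length_zipWith, h0, h1, min_self, Nat.add_sub_cancel, List.getElem?_zipWith]
    rw [List.getElem?_eq_getElem (by rw [h0]; exact hg), List.getElem?_eq_getElem (by rw [h1]; exact hg)]
    rfl

/-- **Correctness of the tensor transform**: entry `g` of `boxTr m φ l` is
`Σ_h (tabOf l h) · Π_i φ_i (g i) (h i)`. [this work] -/
theorem boxTr_eq : ∀ (m : ℕ) (φ : Fin m → Bool → Bool → ℤ) (l : List ℤ), l.length = 2 ^ m →
    ∀ g : Fin m → Bool, tabOf (boxTr m φ l) g = ∑ h : Fin m → Bool, tabOf l h * ∏ i, φ i (g i) (h i)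
  | 0, φ, l, hl, g => by
    simp [boxTr, tabOf, enc2, Finset.univ_unique]
  | m + 1, φ, l, hl, g => by
    have h1 : (l.take (2 ^ m)).length = 2 ^ m := by rw [List.length_take, hl, pow_succ]; omega
    have h2 : (l.drop (2 ^ m)).length = 2 ^ m := by rw [List.length_drop, hl, pow_succ]; omega
    have hg : g = Fin.snoc (fun i => g (Fin.castSucc i)) (g (Fin.last m)) := by
      rw [show (fun i => g (Fin.castSucc i)) = Fin.init g from rfl, Fin.snoc_init_self]
    rw [hg]
    set g' : Fin m → Bool := fun i => g (Fin.castSucc i)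
    set b := g (Fin.last m)
    unfold tabOf
    rw [enc2_snoc]
    unfold boxTr
    rw [getD_boxStep _ _ _ (length_boxTr m _ _ h1) (length_boxTr m _ _ h2) g' b]
    have e0 := boxTr_eq m (fun i => φ (Fin.castSucc i)) (l.take (2 ^ m)) h1 g'
    have e1 := boxTr_eq m (fun i => φ (Fin.castSucc i)) (l.drop (2 ^ m)) h2 g'
    unfold tabOf at e0 e1
    rw [e0, e1, sum_corner_succ, Finset.mul_sum, Finset.mul_sum]
    congr 1
    · refine Finset.sum_congr rfl fun h _ => ?_
      rw [enc2_snoc, Fin.prod_univ_castSucc]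
      simp only [Fin.snoc_castSucc, Fin.snoc_last, Bool.toNat_false, zero_mul, add_zero]
      rw [List.getD_eq_getElem?_getD, List.getD_eq_getElem?_getD (l := l),
        List.getElem?_take_of_lt (enc2_lt h)]
      ring
    · refine Finset.sum_congr rfl fun h _ => ?_
      rw [enc2_snoc, Fin.prod_univ_castSucc]
      simp only [Fin.snoc_castSucc, Fin.snoc_last, Bool.toNat_true, one_mul]
      rw [List.getD_eq_getElem?_getD, List.getD_eq_getElem?_getD (l := l), List.getElem?_drop,
        add_comm (2 ^ m)]
      ring


/-! ## Bits of `enc2` and nonnegative-table Kronecker numbers by shifts -/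

/-- Bit `i` of `enc2 g` is `g i`. [this work] -/
theorem testBit_enc2 : ∀ {m : ℕ} (g : Fin m → Bool) (i : Fin m), (enc2 g).testBit i = g i
  | 0, _, i => i.elim0
  | m + 1, g, i => by
    have hg : g = Fin.snoc (fun j => g (Fin.castSucc j)) (g (Fin.last m)) := by
      rw [show (fun j => g (Fin.castSucc j)) = Fin.init g from rfl, Fin.snoc_init_self]
    rw [hg, enc2_snoc]
    set g' : Fin m → Bool := fun j => g (Fin.castSucc j)
    have hlt := enc2_lt g'
    refine Fin.lastCases ?_ (fun j => ?_) i
    · simp only [Fin.snoc_last, Fin.val_last]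
      cases g (Fin.last m)
      · simp only [Bool.toNat_false, zero_mul, add_zero]
        exact Nat.testBit_lt_two_pow hlt
      · simp only [Bool.toNat_true, one_mul]
        rw [add_comm, Nat.testBit_two_pow_add_eq, Nat.testBit_lt_two_pow hlt]
        rfl
    · simp only [Fin.snoc_castSucc, Fin.val_castSucc]
      cases g (Fin.last m)
      · simp only [Bool.toNat_false, zero_mul, add_zero]
        exact testBit_enc2 g' j
      · simp only [Bool.toNat_true, one_mul]
        rw [add_comm, Nat.testBit_two_pow_add_gt j.2]
        exact testBit_enc2 g' j

/-- Bits of `enc2 g` above `m` vanish. [this work] -/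
theorem testBit_enc2_of_le {m : ℕ} (g : Fin m → Bool) (i : ℕ) (hi : m ≤ i) : (enc2 g).testBit i = false :=
  Nat.testBit_lt_two_pow (lt_of_lt_of_le (enc2_lt g) (Nat.pow_le_pow_right (by norm_num) hi))

/-- Fast Kronecker number of a NONNEGATIVE list-table (naturals) in base `2^s`, by shifts. [this work] -/
def krN (s : ℕ) : ℕ → List ℕ → ℕ
  | 0, l => l.getD 0 0
  | L + 1, l => krN s L (l.take (2 ^ L)) + (krN s L (l.drop (2 ^ L))) <<< (s * 3 ^ L)

/-- `krN` agrees with `krL` on the casts. [this work] -/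
theorem krN_eq_krL : ∀ (s L : ℕ) (l : List ℕ), (krN s L l : ℤ) = krL s L (l.map ((↑) : ℕ → ℤ))
  | s, 0, l => by simp [krN, krL, List.getD_eq_getElem?_getD, List.getElem?_map]; cases l[0]? <;> simp
  | s, L + 1, l => by
    unfold krN krL
    rw [Nat.shiftLeft_eq, ← List.map_take, ← List.map_drop]
    push_cast
    rw [krN_eq_krL s L, krN_eq_krL s L]

/-- **Correctness of `krN`**: `krN s m l = KR (2^s) (tabOf (l.map cast))` for `l.length = 2^m`. [this work] -/
theorem krN_eq (s L : ℕ) (l : List ℕ) (hl : l.length = 2 ^ L) :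
    (krN s L l : ℤ) = KR (2 ^ s) (tabOf (m := L) (l.map ((↑) : ℕ → ℤ))) := by
  rw [krN_eq_krL, krL_eq s L _ (by rw [List.length_map, hl])]

end Summit.CriticalPhenomena.PercolationContinuityZ3.Theorems.OneCutCert
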